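import Literature.RingTheory.Elimination.PerturbedCharpoly
import HarnessLib

/-!
# The limit lemma at an ISOLATED zero: Canny's generalised characteristic polynomial in the
# presence of excess components

Topic: `Literature/RingTheory/Elimination`; sequel of `PerturbedCharpoly.lean`. There the limit
lemma `eval_sLead_pertCharpoly_eq_zero` (Canny, *Generalised characteristic polynomials*,
J. Symbolic Comput. 9 (1990), Thm. 3.2, made elementary for triangular rewriting) is proved under
the hypothesis that the whole zero set `Z(F) ⊆ Kⁿ` of the square system `F_1, …, F_n` is FINITE.
Canny's point, however, is that the generalised characteristic polynomial still sees every
ISOLATED solution when the system also has components of positive dimension ("excess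
components"). This file proves that local form, with the same proof: for `z ∈ Z(F)` such that
`Z(F) ∩ {g ≠ 0}` is finite for some polynomial `g` with `g(z) ≠ 0`,

* `eval_sLead_pertCharpoly_eq_zero_of_isolated` — `Q_u(u(z)) = 0` for the leading `s`-form
  `Q_u = sLead (pertCharpoly D F u k)`;
* `card_le_pow_of_isolated` — hence any finite set of such isolated zeros has at most `Dⁿ`
  elements (`deg F_i < D`), whatever the positive-dimensional part of `Z(F)`;
* `pertCharpoly_map` — the perturbed characteristic polynomial commutes with ring homomorphisms
  of the coefficient ring (used to specialise parameters in the coefficients).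

In the proof of the limit lemma the finiteness of `Z(F)` enters only once: a minimal prime `𝔭` of
`I = (ε X_i^D + F_i) ⊆ K[ε, X]` below the maximal ideal of `(0, z)` and containing `ε` has
`Z(𝔭) ⊆ {0} × Z(F)`, and one needs `Z(𝔭) = {(0, z)}`. Locally this still holds: `g ∉ 𝔭`, and
for `p' ∈ Z(𝔭)`, `p' ≠ (0, z)`, the product of `g`, of `X_j - z_j` and of the `X_j - c` over the
finitely many `j`-th coordinates `c ≠ z_j` of points of `Z(𝔭) ∩ {g ≠ 0}` vanishes on `Z(𝔭)`,
so lies in the prime `𝔭 = I(Z(𝔭))` — and no factor can.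

## References

* J. Canny, *Generalised characteristic polynomials*, J. Symbolic Comput. 9 (1990) 241–250,
  Thm. 3.2. [Canny1990GCP]
* P. Bürgisser, *Cook's versus Valiant's hypothesis*, TCS 235 (2000), Lemma 4.3. [Burgisser2000TCS]
-/

namespace Literature.RingTheory.Elimination

open MvPolynomial

variable {R : Type*} [CommRing R] {n D : ℕ}

/-! ### Change of coefficient ring -/

/-- `mapRingHom f ∘ C = C ∘ f` on `R → R'[s]`. [folklore] -/
private theorem mapRingHom_comp_C_eq {R' : Type*} [CommRing R'] (f : R →+* R') :
    (Polynomial.mapRingHom f).comp Polynomial.C =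
      (Polynomial.C : R' →+* Polynomial R').comp f := by
  ext m
  simp

/-- The perturbed tails commute with a change of coefficients `f : R → R'`. [folklore] -/
private theorem pertTail_map {R' : Type*} [CommRing R'] (f : R →+* R')
    (F : Fin n → MvPolynomial (Fin n) R) (i : Fin n) :
    MvPolynomial.map (Polynomial.mapRingHom f) (pertTail F i) =
      pertTail (fun i => MvPolynomial.map f (F i)) i := by
  unfold pertTail
  rw [map_neg, map_mul, map_C, Polynomial.coe_mapRingHom, Polynomial.map_X, map_map, map_map,
    mapRingHom_comp_C_eq]

/-- The perturbed rewriting matrix commutes with a change of coefficients. [folklore] -/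
private theorem pertMatrix_map {R' : Type*} [CommRing R'] (f : R →+* R')
    (F : Fin n → MvPolynomial (Fin n) R) (u : MvPolynomial (Fin n) R) (k : ℕ) :
    (pertMatrix D F u k).map (Polynomial.mapRingHom f) =
      pertMatrix D (fun i => MvPolynomial.map f (F i)) (MvPolynomial.map f u) k := by
  unfold pertMatrix
  rw [rewriteMatrix_map]
  have h1 : (fun i => MvPolynomial.map (Polynomial.mapRingHom f) (pertTail F i)) =
      pertTail (fun i => MvPolynomial.map f (F i)) := funext (pertTail_map f F)
  have h2 : MvPolynomial.map (Polynomial.mapRingHom f) (MvPolynomial.map Polynomial.C u) =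
      MvPolynomial.map Polynomial.C (MvPolynomial.map f u) := by
    rw [map_map, map_map, mapRingHom_comp_C_eq]
  rw [h1, h2]

/-- **The perturbed characteristic polynomial commutes with a change of coefficients**
`f : R → R'`: `P_u^{f}(s, T) = P_{f u}(s, T)` for the system `(f F_i)` — Canny's generalised
characteristic polynomial is a determinant whose entries are integer polynomials in the
coefficients of the system and of `u`, so it specialises along any ring homomorphism.
[cite: Canny1990GCP, §2] -/
theorem pertCharpoly_map {R' : Type*} [CommRing R'] (f : R →+* R')
    (F : Fin n → MvPolynomial (Fin n) R) (u : MvPolynomial (Fin n) R) (k : ℕ) :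
    (pertCharpoly D F u k).map (Polynomial.mapRingHom f) =
      pertCharpoly D (fun i => MvPolynomial.map f (F i)) (MvPolynomial.map f u) k := by
  unfold pertCharpoly
  rw [← Matrix.charpoly_map, pertMatrix_map]

/-! ### The limit lemma at an isolated zero -/

section Limit

variable {K : Type*} [Field K]

/-- **The limit lemma at an isolated zero** (Canny's GCP argument with excess components). Let
`K` be algebraically closed, `F_1, …, F_n ∈ K[X_1, …, X_n]` of total degree `< D`, `D ≥ 1`,
and `z ∈ Z(F)` an ISOLATED zero in the sense that `Z(F) ∩ {g ≠ 0}` is finite for some `g` with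
`g(z) ≠ 0`. Then for every polynomial `u`, `u(z)` is a root of the leading `s`-form `Q_u` of the
perturbed characteristic polynomial: `Q_u(u(z)) = 0` — no hypothesis on the rest of `Z(F)`.
[cite: Canny1990GCP, Thm. 3.2] -/
theorem eval_sLead_pertCharpoly_eq_zero_of_isolated [IsAlgClosed K] (hD : 0 < D)
    (F : Fin n → MvPolynomial (Fin n) K) (hF : ∀ i, (F i).totalDegree < D)
    {z : Fin n → K} (hz : ∀ i, eval z (F i) = 0)
    {g : MvPolynomial (Fin n) K} (hgz : eval z g ≠ 0)
    (hfin : ({x : Fin n → K | ∀ i, eval x (F i) = 0} ∩ {x | eval x g ≠ 0}).Finite)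
    (u : MvPolynomial (Fin n) K) {k : ℕ} (hk : u.totalDegree + n * (D - 1) + 1 ≤ k) :
    (sLead (pertCharpoly D F u k)).eval (eval z u) = 0 := by
  classical
  set P := pertCharpoly D F u k with hP
  -- the ambient ring `A = K[ε, X_1, …, X_n]`, `ε = X 0`, `X_i ↦ X i.succ`
  have hι : ∀ (p : Fin (n + 1) → K) (q : MvPolynomial (Fin n) K),
      eval p (rename Fin.succ q) = eval (Fin.tail p) q := by
    intro p q; rw [eval_rename]; rfl
  set G : Fin n → MvPolynomial (Fin (n + 1)) K :=
    fun i => X 0 * rename Fin.succ (X i) ^ D + rename Fin.succ (F i) with hG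
  set I : Ideal (MvPolynomial (Fin (n + 1)) K) := Ideal.span (Set.range G) with hI
  have hZI : ∀ p ∈ zeroLocus K I, ∀ i, p 0 * p (Fin.succ i) ^ D + eval (Fin.tail p) (F i) = 0 := by
    intro p hp i
    rw [zeroLocus_span] at hp
    have h := hp (G i) ⟨i, rfl⟩
    rwa [aeval_eq_eval, hG, map_add, map_mul, map_pow, eval_X, hι, hι, eval_X] at h
  -- the element `Φ'` and `ε Φ' ∈ √I`
  set Φ' : MvPolynomial (Fin (n + 1)) K :=
    ∑ k ∈ Finset.range (P.natDegree + 1), ∑ j ∈ Finset.range (sDeg P + 1),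
      MvPolynomial.C ((P.coeff k).coeff j) * X 0 ^ (sDeg P - j) * rename Fin.succ u ^ k with hΦ'def
  have hΦ' : ∀ p : Fin (n + 1) → K, eval p Φ' = revEval P (p 0) (eval (Fin.tail p) u) := by
    intro p
    simp only [hΦ'def, revEval, map_sum, map_mul, map_pow, eval_C, eval_X, hι]
  have hvan : X 0 * Φ' ∈ vanishingIdeal K (zeroLocus K I) := by
    intro p hp
    rw [aeval_eq_eval, map_mul, eval_X, hΦ']
    by_cases h0 : p 0 = 0
    · rw [h0, zero_mul]
    · have hx : ∀ i, (Fin.tail p) i ^ D + (p 0)⁻¹ * eval (Fin.tail p) (F i) = 0 := by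
        intro i
        have h := hZI p hp i
        have : (p 0)⁻¹ * (p 0 * p (Fin.succ i) ^ D + eval (Fin.tail p) (F i)) = 0 := by
          rw [h, mul_zero]
        rw [mul_add, ← mul_assoc, inv_mul_cancel₀ h0, one_mul] at this
        exact this
      rw [revEval_eq_of_ne_zero P h0, eval_map_pertCharpoly_eq_zero hD F hF (p 0)⁻¹ hx u hk,
        mul_zero, mul_zero]
  have hrad : X 0 * Φ' ∈ I.radical := by
    rw [← vanishingIdeal_zeroLocus_eq_radical (K := K)]; exact hvan
  -- the point `(0, z)`, its maximal ideal, and a minimal prime of `I` below it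
  set pt : Fin (n + 1) → K := Fin.cons 0 z with hpt
  have hpt0 : pt 0 = 0 := by rw [hpt]; exact Fin.cons_zero _ _
  have hptt : Fin.tail pt = z := by rw [hpt]; exact Fin.tail_cons _ _
  set 𝔪 : Ideal (MvPolynomial (Fin (n + 1)) K) := vanishingIdeal K ({pt} : Set (Fin (n + 1) → K))
    with h𝔪
  haveI h𝔪max : 𝔪.IsMaximal := by rw [h𝔪]; infer_instance
  have hI𝔪 : I ≤ 𝔪 := by
    rw [hI, Ideal.span_le]
    rintro _ ⟨i, rfl⟩
    rw [SetLike.mem_coe, h𝔪, mem_vanishingIdeal_singleton_iff, aeval_eq_eval, hG]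
    dsimp only
    rw [map_add, map_mul, map_pow, eval_X, hι, hι, eval_X, hpt0, hptt, hz i, zero_mul, zero_add]
  obtain ⟨𝔭, h𝔭min, h𝔭𝔪⟩ := Ideal.exists_minimalPrimes_le hI𝔪
  have h𝔭prime : 𝔭.IsPrime := h𝔭min.1.1
  have hI𝔭 : I ≤ 𝔭 := h𝔭min.1.2
  -- Krull's height theorem: `ht 𝔭 ≤ n`
  have hht : 𝔭.height ≤ n := by
    have h1 : I = Ideal.span (((Finset.univ : Finset (Fin n)).image G : Finset _) : Set _) := by
      rw [hI, Finset.coe_image, Finset.coe_univ, Set.image_univ]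
    have h2 : 𝔭 ∈ (Ideal.span (((Finset.univ : Finset (Fin n)).image G : Finset _) :
        Set (MvPolynomial (Fin (n + 1)) K))).minimalPrimes := h1 ▸ h𝔭min
    refine (Ideal.height_le_card_of_mem_minimalPrimes_span_finset h2).trans ?_
    exact_mod_cast Finset.card_image_le.trans (by simp)
  -- the witness of isolation, moved to `A`: `g' = g(X_1, …, X_n) ∉ 𝔭`
  set g' : MvPolynomial (Fin (n + 1)) K := rename Fin.succ g with hg'
  have hg'pt : eval pt g' = eval z g := by rw [hg', hι, hptt]
  have hg'𝔭 : g' ∉ 𝔭 := by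
    intro h
    have h' := (mem_vanishingIdeal_singleton_iff pt g').1 (by rw [← h𝔪]; exact h𝔭𝔪 h)
    rw [aeval_eq_eval, hg'pt] at h'
    exact hgz h'
  -- `ε ∉ 𝔭`: otherwise `Z(𝔭) = {pt}`, `𝔭 = 𝔪` has height `n + 1`
  have hε : (X 0 : MvPolynomial (Fin (n + 1)) K) ∉ 𝔭 := by
    intro hε
    have hZ𝔭 : zeroLocus K 𝔭 ∩ {p | eval p g' ≠ 0} ⊆
        (fun x : Fin n → K => (Fin.cons 0 x : Fin (n + 1) → K)) ''
          ({x : Fin n → K | ∀ i, eval x (F i) = 0} ∩ {x | eval x g ≠ 0}) := by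
      rintro p ⟨hp, hpg⟩
      have hp0 : p 0 = 0 := by
        have h := hp (X 0) hε
        rwa [aeval_eq_eval, eval_X] at h
      refine ⟨Fin.tail p, ⟨?_, ?_⟩, ?_⟩
      · intro i
        have h := hZI p (zeroLocus_anti_mono hI𝔭 hp) i
        rwa [hp0, zero_mul, zero_add] at h
      · have : eval p g' = eval (Fin.tail p) g := by rw [hg', hι]
        show eval (Fin.tail p) g ≠ 0
        rw [← this]; exact hpg
      · dsimp only
        rw [← hp0]
        exact Fin.cons_self_tail p
    have hfin𝔭 : (zeroLocus K 𝔭 ∩ {p | eval p g' ≠ 0}).Finite := (hfin.image _).subset hZ𝔭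
    have hpt𝔭 : pt ∈ zeroLocus K 𝔭 := fun q hq =>
      (mem_vanishingIdeal_singleton_iff pt q).1 (by rw [← h𝔪]; exact h𝔭𝔪 hq)
    have hsingle : zeroLocus K 𝔭 = {pt} := by
      refine Set.eq_singleton_iff_unique_mem.2 ⟨hpt𝔭, fun p' hp' => ?_⟩
      by_contra hne
      obtain ⟨j, hj⟩ := Function.ne_iff.1 hne
      set Tj : Finset K := hfin𝔭.toFinset.image (fun p => p j) with hTj
      have hab : g' * ((X j - MvPolynomial.C (pt j)) *
          ∏ c ∈ Tj.erase (pt j), (X j - MvPolynomial.C c)) ∈ 𝔭 := by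
        rw [← IsPrime.vanishingIdeal_zeroLocus (K := K) 𝔭]
        intro p hp
        rw [aeval_eq_eval, map_mul, map_mul, map_prod]
        by_cases hpg : eval p g' = 0
        · rw [hpg, zero_mul]
        · by_cases hpj : p j = pt j
          · rw [map_sub, eval_X, eval_C, hpj, sub_self, zero_mul, mul_zero]
          · have hmem : p j ∈ Tj.erase (pt j) :=
              Finset.mem_erase.2 ⟨hpj, Finset.mem_image.2 ⟨p, hfin𝔭.mem_toFinset.2 ⟨hp, hpg⟩, rfl⟩⟩
            rw [Finset.prod_eq_zero hmem (by rw [map_sub, eval_X, eval_C, sub_self]), mul_zero,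
              mul_zero]
      rcases h𝔭prime.mem_or_mem hab with hg | hrest
      · exact hg'𝔭 hg
      rcases h𝔭prime.mem_or_mem hrest with ha | hb
      · have h := hp' _ ha
        rw [aeval_eq_eval, map_sub, eval_X, eval_C, sub_eq_zero] at h
        exact hj h
      · have h := (mem_vanishingIdeal_singleton_iff pt _).1 (by rw [← h𝔪]; exact h𝔭𝔪 hb)
        rw [aeval_eq_eval, map_prod] at h
        obtain ⟨c, hc, hc0⟩ := Finset.prod_eq_zero_iff.1 h
        rw [map_sub, eval_X, eval_C, sub_eq_zero] at hc0
        exact (Finset.mem_erase.1 hc).1 hc0.symm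
    have h𝔭eq : 𝔭 = 𝔪 := by
      rw [← IsPrime.vanishingIdeal_zeroLocus (K := K) 𝔭, hsingle]
    have hh : 𝔪.height = (n + 1 : ℕ) := by
      rw [h𝔪]; exact height_vanishingIdeal_singleton pt
    rw [h𝔭eq, hh] at hht
    have : n + 1 ≤ n := by exact_mod_cast hht
    omega
  -- conclusion: `Φ' ∈ 𝔭 ⊆ 𝔪`, so `Φ'(pt) = Q_u(u(z)) = 0`
  have hΦ'𝔭 : Φ' ∈ 𝔭 := by
    rcases h𝔭prime.mem_or_mem ((Ideal.IsPrime.radical_le_iff h𝔭prime).2 hI𝔭 hrad) with h | h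
    · exact absurd h hε
    · exact h
  have h := (mem_vanishingIdeal_singleton_iff pt Φ').1 (by rw [← h𝔪]; exact h𝔭𝔪 hΦ'𝔭)
  rw [aeval_eq_eval, hΦ', hpt0, hptt, revEval_zero] at h
  exact h

/-- **Refined Bézout-type count for isolated zeros.** Over an algebraically closed field, any
finite set of ISOLATED common zeros of `n` polynomials of total degree `< D` in `n` variables —
each `z` with a polynomial `g_z`, `g_z(z) ≠ 0`, `Z(F) ∩ {g_z ≠ 0}` finite — has at most `Dⁿ`
elements, whatever the positive-dimensional part of `Z(F)`. (Separate the points by a linear form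
`u`; by the local limit lemma their `u`-values are roots of `Q_u ≠ 0`, `deg Q_u ≤ Dⁿ`.)
[cite: Canny1990GCP, Thm. 3.2] -/
theorem card_le_pow_of_isolated [IsAlgClosed K] (hD : 0 < D) (F : Fin n → MvPolynomial (Fin n) K)
    (hF : ∀ i, (F i).totalDegree < D) (Z : Finset (Fin n → K))
    (hZ : ∀ z ∈ Z, (∀ i, eval z (F i) = 0) ∧ ∃ g : MvPolynomial (Fin n) K, eval z g ≠ 0 ∧
      ({x : Fin n → K | ∀ i, eval x (F i) = 0} ∩ {x | eval x g ≠ 0}).Finite) :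
    Z.card ≤ D ^ n := by
  classical
  -- a linear form separating the points of `Z`
  obtain ⟨c, hc⟩ : ∃ c : Fin n → K, ∀ p ∈ Z, ∀ q ∈ Z, p ≠ q → ∑ i, c i * (p i - q i) ≠ 0 := by
    set Ψ : MvPolynomial (Fin n) K :=
      ∏ pq ∈ (Z ×ˢ Z).filter (fun pq => pq.1 ≠ pq.2), ∑ i, MvPolynomial.C (pq.1 i - pq.2 i) * X i
      with hΨ
    have hΨ0 : Ψ ≠ 0 := by
      rw [hΨ, Finset.prod_ne_zero_iff]
      intro pq hpq hzero
      obtain ⟨i, hi⟩ := Function.ne_iff.1 (Finset.mem_filter.1 hpq).2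
      have h := congrArg (coeff (Finsupp.single i 1)) hzero
      rw [coeff_sum, coeff_zero, Finset.sum_eq_single i] at h
      · rw [coeff_C_mul, coeff_X, if_pos rfl, mul_one, sub_eq_zero] at h
        exact hi h
      · intro b _ hb
        rw [coeff_C_mul, coeff_X,
          if_neg (by rw [Finsupp.single_left_inj one_ne_zero]; exact hb), mul_zero]
      · intro h; exact absurd (Finset.mem_univ i) h
    obtain ⟨c, hc⟩ : ∃ c : Fin n → K, eval c Ψ ≠ 0 := by
      by_contra h
      push Not at h
      exact hΨ0 (MvPolynomial.funext fun x => by rw [h x, map_zero])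
    refine ⟨c, fun p hp q hq hpq => ?_⟩
    rw [hΨ, map_prod] at hc
    have h := Finset.prod_ne_zero_iff.1 hc (p, q) (Finset.mem_filter.2 ⟨Finset.mem_product.2 ⟨hp, hq⟩, hpq⟩)
    simpa [map_sum, eval_C, eval_X, mul_comm] using h
  set u : MvPolynomial (Fin n) K := ∑ i, MvPolynomial.C (c i) * X i with hu
  set Q := sLead (pertCharpoly D F u (u.totalDegree + n * (D - 1) + 1)) with hQ
  have hQ0 : Q ≠ 0 := sLead_ne_zero (pertCharpoly_ne_zero _ _ _ _)
  have hroot : ∀ p ∈ Z, eval p u ∈ Q.roots.toFinset := by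
    intro p hp
    rw [Multiset.mem_toFinset, Polynomial.mem_roots hQ0, Polynomial.IsRoot.def]
    obtain ⟨hpF, g, hg, hgfin⟩ := hZ p hp
    exact eval_sLead_pertCharpoly_eq_zero_of_isolated hD F hF hpF hg hgfin u le_rfl
  have hinj : Set.InjOn (fun p : Fin n → K => eval p u) Z := by
    intro p hp q hq hpq
    by_contra hne
    apply hc p hp q hq hne
    have : eval p u - eval q u = ∑ i, c i * (p i - q i) := by
      simp only [hu, map_sum, map_mul, eval_C, eval_X, ← Finset.sum_sub_distrib, mul_sub]
    rw [← this, sub_eq_zero]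
    exact hpq
  calc Z.card ≤ Q.roots.toFinset.card := Finset.card_le_card_of_injOn _ hroot hinj
    _ ≤ Multiset.card Q.roots := Multiset.toFinset_card_le _
    _ ≤ Q.natDegree := Polynomial.card_roots' Q
    _ ≤ D ^ n := natDegree_sLead_pertCharpoly_le _ _ _ _

end Limit

end Literature.RingTheory.Elimination
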